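import Literature.Probability.RandomPlanarGeometry.HexSAWBrickWallStripFugacityWidthOneContactBerryEsseen
import Literature.Probability.RandomPlanarGeometry.HexSAWBrickWallStripFugacityWidthOneOffAxisDecay
import Literature.Probability.RandomPlanarGeometry.HexSAWBrickWallStripFugacityWidthOneContactInversion
import Literature.Probability.Independence.LatticeLocalLimitDisplay
import HarnessLib

/-!
# The local central limit theorem, with rate `1/√N`, for the contact number of hexagonal-lattice
# self-avoiding walks in the width-one brick-wall strip

Topic `Literature/Probability/RandomPlanarGeometry` (continues `…WidthOneContactBerryEsseen.lean` — the inner and outer windows of the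
standardised characteristic function —, `…WidthOneOffAxisDecay.lean` — the geometric decay of `C_{1,N}(ye^{iu}, z)` off the positive
axis —, `…WidthOneContactInversion.lean` — the law of `bc` as a lattice law — and the model-free subtraction step
`Literature/Probability/Independence/LatticeLocalLimitDisplay.lean`).

For the Boltzmann measure `P_{N,y,z}` (weights `y^{bc} z^{tc}/C_{1,N}(y,z)` on the self-avoiding walks of length `N` in the width-one strip,
Beaton et al. §3.2) with `y, z > 0` and `y ≠ z + 1`, the contact number `bc` satisfies the LOCAL limit theorem with the optimal rate:
there is `C = C(y,z)` such that for every `N ≥ 1` and every integer `m`,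
`|σ√N · P_{N,y,z}(bc = m) − (2π)^{−1/2} exp(−(m − N b)²/(2σ²N))| ≤ C/√N`,
`b = b(y,z)` the contact density and `σ² = d/dA b(e^A, z)|_{A = log y} > 0` the CLT variance.  This is Durrett's Theorem 3.5.3 for the
(dependent) transfer-matrix statistic `bc`, sharpened to a rate: by the inversion formula on `ℤ` the scaled atom is a Fourier integral over
`[−πσ√N, πσ√N]`; on `|θ| ≤ 1/√N` the first-moment bound, on `1/√N < |θ| < δ√N` the complex two-term asymptotics (`e^{−θ²/2 + E}·q`,
`‖E‖ ≤ K(|θ| + |θ|³)/√N`), and on the arc `δ√N ≤ |θ| ≤ πσ√N` the off-axis decay `‖C_{1,N}(ye^{iu}, z)‖ ≤ K(M+1)²ρ^M`, `ρ < s`, against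
`C_{1,N}(y,z) ≥ A₀ s^M/2` give an integrable majorant `C₁e^{−θ²/8}/√N + O((M+1)³(ρ/s)^M √N + √N e^{−δ²N/2})`.  (The excluded line
`y = z + 1` is where the discriminant factor of the off-axis recurrence vanishes on the circle `|w| = y`; the theorem is expected to hold
there too, by the order-14 recurrence of `C_{1,N}` itself — not treated here.)

* `abs_mul_exp_quad_le` — the window majorant `|θ|e^{−θ²/4}(a + bθ²) ≤ 2(a + 16b)e^{−θ²/8}`.
* `exists_cube_geom_le_one` — `C(M+1)³ϑ^M ≤ 1` eventually (`0 ≤ ϑ < 1`).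
* `charFun_count_scaled_eq` — the inversion integrand is the characteristic function of the standardised law.
* `norm_charFun_contactLaw_map` — `‖φ(θ)‖ = ‖C_{1,N}(ye^{iaθ/√N}, z)‖/C_{1,N}(y,z)`.
* `contact_localCLT_parity` — the estimate along `N = 2M + c`.
* ★★★ `contact_localCLT` — the local limit theorem with rate `C/√N`, all `N ≥ 1`, uniformly in `m ∈ ℤ`.

## Sources
R. Durrett, *Probability: Theory and Examples* (2019) §3.5 Theorem 3.5.3 (local limit theorem for lattice laws: the three-piece
estimate of `∫|φ_n − e^{−t²/2}|`) and §3.3 Exercise 3.3.2 (inversion on a lattice) — the lane statement follows that proof for a dependent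
statistic, with the transfer-matrix inputs of the files above; N. R. Beaton, M. Bousquet-Mélou, J. de Gier, H. Duminil-Copin, A. J. Guttmann,
CMP 326 (2014), arXiv:1109.0358v5 §3.2 Proposition 6 (p. 10: the width-one partition functions).  Nothing is quoted AS PRINTED: the rate form
for `bc` is this lane's statement («pcv-sawmu», a-p5 g28, DOOR item 1).
-/

noncomputable section

open MeasureTheory ProbabilityTheory Filter Finset Complex Set
open Literature.Probability.LatticeModels Literature.Probability.Percolation Literature.Probability.Independence
open Literature.Probability.Distributions
open scoped Topology Real

namespace Literature.Probability.RandomPlanarGeometry.SAW.HexBW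

namespace WidthOneYZ

variable {y z : ℝ}

/-! ## §1 Two pure lemmas -/

/-- **The window majorant**: for `a, b ≥ 0` and all real `θ`, `|θ|·e^{−θ²/4}·(a + bθ²) ≤ 2(a + 16b)·e^{−θ²/8}`
(`|θ| ≤ 2(1 + θ²/16)`, `a + bθ² ≤ (a + 16b)(1 + θ²/16)` and `(1 + θ²/16)e^{−θ²/16} ≤ 1`).
[cite: Durrett2019, §3.5 proof of Theorem 3.5.3 (lane plumbing: an integrable Gaussian majorant)] -/
theorem abs_mul_exp_quad_le {a b : ℝ} (ha : 0 ≤ a) (hb : 0 ≤ b) (θ : ℝ) :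
    |θ| * Real.exp (-θ ^ 2 / 4) * (a + b * θ ^ 2) ≤ 2 * (a + 16 * b) * Real.exp (-(1 / 8 : ℝ) * θ ^ 2) := by
  have h1 : |θ| ≤ 2 * (1 + θ ^ 2 / 16) := by nlinarith [sq_nonneg (|θ| - 4), sq_abs θ, abs_nonneg θ]
  have h2 : a + b * θ ^ 2 ≤ (a + 16 * b) * (1 + θ ^ 2 / 16) := by nlinarith [sq_nonneg θ, mul_nonneg ha (sq_nonneg θ)]
  have h3 : 1 + θ ^ 2 / 16 ≤ Real.exp (θ ^ 2 / 16) := by linarith [Real.add_one_le_exp (θ ^ 2 / 16)]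
  have h4 : Real.exp (-θ ^ 2 / 4) = Real.exp (-(1 / 8 : ℝ) * θ ^ 2) * (Real.exp (-(θ ^ 2 / 16))) ^ 2 := by
    rw [← Real.exp_nat_mul, ← Real.exp_add]
    congr 1; push_cast; ring
  have h5 : Real.exp (-(θ ^ 2 / 16)) * (1 + θ ^ 2 / 16) ≤ 1 := by
    rw [Real.exp_neg, inv_mul_le_iff₀ (Real.exp_pos _), mul_one]
    exact h3
  have h0 : 0 ≤ 1 + θ ^ 2 / 16 := by positivity
  calc |θ| * Real.exp (-θ ^ 2 / 4) * (a + b * θ ^ 2)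
      ≤ (2 * (1 + θ ^ 2 / 16)) * Real.exp (-θ ^ 2 / 4) * ((a + 16 * b) * (1 + θ ^ 2 / 16)) := by gcongr
    _ = 2 * (a + 16 * b) * Real.exp (-(1 / 8 : ℝ) * θ ^ 2) * (Real.exp (-(θ ^ 2 / 16)) * (1 + θ ^ 2 / 16)) ^ 2 := by
        rw [h4]; ring
    _ ≤ 2 * (a + 16 * b) * Real.exp (-(1 / 8 : ℝ) * θ ^ 2) * 1 ^ 2 := by gcongr
    _ = 2 * (a + 16 * b) * Real.exp (-(1 / 8 : ℝ) * θ ^ 2) := by ring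

/-- **Polynomial times geometric is eventually small**: for `0 ≤ ϑ < 1` and any `C`, `C·(M+1)³·ϑ^M ≤ 1` for all large `M`.
[cite: Durrett2019, §3.5 proof of Theorem 3.5.3 (lane plumbing)] -/
theorem exists_cube_geom_le_one (C : ℝ) {ϑ : ℝ} (hϑ0 : 0 ≤ ϑ) (hϑ1 : ϑ < 1) :
    ∃ M₀ : ℕ, ∀ M : ℕ, M₀ ≤ M → C * ((M : ℝ) + 1) ^ 3 * ϑ ^ M ≤ 1 := by
  have h3 := tendsto_pow_const_mul_const_pow_of_lt_one 3 hϑ0 hϑ1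
  have h2 := tendsto_pow_const_mul_const_pow_of_lt_one 2 hϑ0 hϑ1
  have h1 := tendsto_pow_const_mul_const_pow_of_lt_one 1 hϑ0 hϑ1
  have h0 := tendsto_pow_atTop_nhds_zero_of_lt_one hϑ0 hϑ1
  have hsum : Tendsto (fun M : ℕ => C * ((M : ℝ) ^ 3 * ϑ ^ M + 3 * ((M : ℝ) ^ 2 * ϑ ^ M) + 3 * ((M : ℝ) ^ 1 * ϑ ^ M) + ϑ ^ M))
      atTop (𝓝 (C * (0 + 3 * 0 + 3 * 0 + 0))) :=
    (((h3.add (h2.const_mul 3)).add (h1.const_mul 3)).add h0).const_mul C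
  simp only [mul_zero, add_zero] at hsum
  have hev := hsum.eventually (ge_mem_nhds zero_lt_one)
  obtain ⟨M₀, hM₀⟩ := eventually_atTop.1 hev
  refine ⟨M₀, fun M hM => ?_⟩
  have h := hM₀ M hM
  have e : C * ((M : ℝ) + 1) ^ 3 * ϑ ^ M
      = C * ((M : ℝ) ^ 3 * ϑ ^ M + 3 * ((M : ℝ) ^ 2 * ϑ ^ M) + 3 * ((M : ℝ) ^ 1 * ϑ ^ M) + ϑ ^ M) := by ring
  rw [e]; exact h

/-! ## §2 The inversion integrand is the standardised characteristic function -/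

/-- **The inversion integrand**: for `N ≥ 1` and `σ > 0`,
`φ_{bc}(θ/(σ√N))·e^{−iθ·(N b)/(σ√N)} = φ_{law(σ⁻¹(bc − N b)/√N)}(θ)` — the integrand of the lattice inversion display is the
characteristic function of the standardised contact number. [cite: Durrett2019, §3.5 proof of Theorem 3.5.3, first display (lane plumbing); BeatonBousquetMelouDeGierDuminilCopinGuttmann2014, §3.2 Proposition 6 (arXiv v5 p. 10)] -/
theorem charFun_count_scaled_eq (hy : 0 < y) (hz : 0 < z) {N : ℕ} (hN : 1 ≤ N) {σ : ℝ} (hσ : 0 < σ) (θ : ℝ) :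
    charFun (finLaw (stripPairs 1 N) (fun q => wgt y z N q / stripZ₂ 1 N y z) (fun q => (bottomVisits₀ q.1 q.2 N : ℝ)))
        (θ / (σ * Real.sqrt N)) * cexp (-((θ : ℂ) * ((((N : ℝ) * contactB y z) / (σ * Real.sqrt N) : ℝ) : ℂ) * I))
      = charFun ((contactLaw y z N).map (fun u => σ⁻¹ * u)) θ := by
  have hsq : Real.sqrt (N : ℝ) ≠ 0 := (Real.sqrt_pos.2 (by exact_mod_cast hN : (0 : ℝ) < N)).ne'
  have e0 : ((N : ℝ) * contactB y z) / (σ * Real.sqrt N) = σ⁻¹ * Real.sqrt N * contactB y z := by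
    rw [div_eq_iff (mul_ne_zero hσ.ne' hsq)]
    have key : Real.sqrt (N : ℝ) * Real.sqrt N = N := Real.mul_self_sqrt (Nat.cast_nonneg N)
    field_simp
    linear_combination contactB y z * key.symm
  rw [charFun_contactCountLaw hy hz, charFun_contactLaw_map hy hz, e0]
  push_cast
  ring_nf

/-- **The modulus of the standardised characteristic function**: `‖φ_{law(a(bc − Nb)/√N)}(θ)‖ = ‖C_{1,N}(ye^{iaθ/√N}, z)‖/C_{1,N}(y,z)`.
[cite: Durrett2019, §3.3 Theorem 3.3.1 (lane plumbing); BeatonBousquetMelouDeGierDuminilCopinGuttmann2014, §3.2 Proposition 6 (arXiv v5 p. 10)] -/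
theorem norm_charFun_contactLaw_map (hy : 0 < y) (hz : 0 < z) (N : ℕ) (a θ : ℝ) :
    ‖charFun ((contactLaw y z N).map (fun u => a * u)) θ‖
      = ‖stripZ₂C 1 N ((y : ℂ) * cexp (((a * θ / Real.sqrt N : ℝ) : ℂ) * I)) (z : ℂ)‖ / stripZ₂ 1 N y z := by
  rw [charFun_contactLaw_map hy hz, norm_mul, norm_div]
  have hph : ‖cexp (-((((a * θ : ℝ)) : ℂ) * (Real.sqrt N : ℂ) * (contactB y z : ℂ) * I))‖ = 1 := by
    rw [show -((((a * θ : ℝ)) : ℂ) * (Real.sqrt N : ℂ) * (contactB y z : ℂ) * I)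
        = ((-(a * θ * Real.sqrt N * contactB y z) : ℝ) : ℂ) * I by push_cast; ring, norm_exp_ofReal_mul_I]
  have harg : (((a * θ : ℝ)) : ℂ) / (Real.sqrt N : ℂ) = ((a * θ / Real.sqrt N : ℝ) : ℂ) := by push_cast; ring
  rw [hph, mul_one, harg, Complex.norm_real, Real.norm_of_nonneg (stripZ₂_pos 1 N hy hz).le]

/-! ## §3 The pieces of the estimate (pure real lemmas) -/

/-- Inner piece: `A₁|θ| ≤ (C₁/r)·e^{−θ²/8}` for `|θ| ≤ 1/r ≤ 1` and `3A₁ ≤ C₁`. [cite: Durrett2019, §3.5 proof of Theorem 3.5.3 (lane plumbing)] -/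
private theorem inner_piece {A₁ C₁ r θ : ℝ} (hr : 1 ≤ r) (hA : 0 ≤ A₁) (hC : 3 * A₁ ≤ C₁) (h1 : |θ| ≤ 1 / r) :
    A₁ * |θ| ≤ C₁ / r * Real.exp (-(1 / 8 : ℝ) * θ ^ 2) := by
  have hr0 : 0 < r := lt_of_lt_of_le one_pos hr
  have hθ1 : |θ| ≤ 1 := h1.trans (by rw [div_le_one hr0]; exact hr)
  have hθsq : θ ^ 2 ≤ 1 := by nlinarith only [abs_nonneg θ, sq_abs θ, hθ1]
  have he : 1 ≤ 3 * Real.exp (-(1 / 8 : ℝ) * θ ^ 2) := by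
    have h2 : -(1 / 8 : ℝ) + 1 ≤ Real.exp (-(1 / 8 : ℝ)) := Real.add_one_le_exp _
    have h3 : Real.exp (-(1 / 8 : ℝ)) ≤ Real.exp (-(1 / 8 : ℝ) * θ ^ 2) := Real.exp_le_exp.2 (by linarith only [hθsq])
    linarith only [h2, h3]
  have hpos : 0 ≤ A₁ * (1 / r) := by positivity
  calc A₁ * |θ| ≤ A₁ * (1 / r) := mul_le_mul_of_nonneg_left h1 hA
    _ ≤ A₁ * (1 / r) * (3 * Real.exp (-(1 / 8 : ℝ) * θ ^ 2)) := le_mul_of_one_le_right hpos he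
    _ = (3 * A₁) / r * Real.exp (-(1 / 8 : ℝ) * θ ^ 2) := by ring
    _ ≤ C₁ / r * Real.exp (-(1 / 8 : ℝ) * θ ^ 2) := by gcongr

/-- Window piece: the bound of `norm_sub_gauss_le_of_cubic_mul` is `≤ (C₁/r)·e^{−θ²/8}` once `2((6K_c+1) + 96K_c) ≤ C₁`.
[cite: Durrett2019, §3.5 proof of Theorem 3.5.3 (lane plumbing)] -/
private theorem window_piece {Kc C₁ r θ : ℝ} (hr : 0 < r) (hKc : 0 ≤ Kc) (hC : 2 * ((6 * Kc + 1) + 16 * (6 * Kc)) ≤ C₁) :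
    |θ| * Real.exp (-θ ^ 2 / 4) * (((6 * Kc + 1) + 6 * Kc * θ ^ 2) / r) ≤ C₁ / r * Real.exp (-(1 / 8 : ℝ) * θ ^ 2) := by
  have hmaj := abs_mul_exp_quad_le (a := 6 * Kc + 1) (b := 6 * Kc) (by positivity) (by positivity) θ
  have hexp0 : 0 ≤ Real.exp (-(1 / 8 : ℝ) * θ ^ 2) := (Real.exp_pos _).le
  calc |θ| * Real.exp (-θ ^ 2 / 4) * (((6 * Kc + 1) + 6 * Kc * θ ^ 2) / r)
      = (|θ| * Real.exp (-θ ^ 2 / 4) * ((6 * Kc + 1) + 6 * Kc * θ ^ 2)) / r := by ring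
    _ ≤ (2 * ((6 * Kc + 1) + 16 * (6 * Kc)) * Real.exp (-(1 / 8 : ℝ) * θ ^ 2)) / r := by gcongr
    _ = (2 * ((6 * Kc + 1) + 16 * (6 * Kc))) / r * Real.exp (-(1 / 8 : ℝ) * θ ^ 2) := by ring
    _ ≤ C₁ / r * Real.exp (-(1 / 8 : ℝ) * θ ^ 2) := by gcongr

/-- The partition function is at least half its leading term, eventually: from `|Z − A₀s^M| ≤ K(M+1)Θ^M` and
`(2K/A₀)(M+1)³(Θ/s)^M ≤ 1`. [cite: Durrett2019, §3.5 proof of Theorem 3.5.3 (lane plumbing); BeatonBousquetMelouDeGierDuminilCopinGuttmann2014, §3.2 Proposition 6 (arXiv v5 p. 10)] -/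
private theorem half_leading_le {Z A₀ s K Θ : ℝ} {M : ℕ} (hA₀ : 0 < A₀) (hs : 0 < s) (hK : 0 ≤ K) (hΘ : 0 ≤ Θ)
    (h : |Z - A₀ * s ^ M| ≤ K * ((M : ℝ) + 1) * Θ ^ M) (hM : 2 * K / A₀ * ((M : ℝ) + 1) ^ 3 * (Θ / s) ^ M ≤ 1) :
    A₀ * s ^ M / 2 ≤ Z := by
  have hΘpow : Θ ^ M = (Θ / s) ^ M * s ^ M := by
    rw [div_pow, div_mul_cancel₀ _ (pow_ne_zero _ hs.ne')]
  have hM1 : ((M : ℝ) + 1) ≤ ((M : ℝ) + 1) ^ 3 :=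
    le_self_pow₀ (by linarith [(Nat.cast_nonneg M : (0 : ℝ) ≤ M)]) (by norm_num)
  have hpos : 0 ≤ A₀ * s ^ M / 2 := by positivity
  have h1 : K * ((M : ℝ) + 1) * Θ ^ M ≤ A₀ * s ^ M / 2 := by
    calc K * ((M : ℝ) + 1) * Θ ^ M ≤ K * ((M : ℝ) + 1) ^ 3 * Θ ^ M := by gcongr
      _ = (A₀ * s ^ M / 2) * ((2 * K / A₀) * ((M : ℝ) + 1) ^ 3 * (Θ / s) ^ M) := by
          rw [hΘpow]; field_simp
      _ ≤ (A₀ * s ^ M / 2) * 1 := by gcongr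
      _ = A₀ * s ^ M / 2 := mul_one _
  have h2 := (abs_le.1 h).1
  linarith only [h1, h2]

/-- Arc piece (a): `a_N · 2πσ√N ≤ 1/√N` for `a_N = K₇(M+1)²ρ^M/(A₀s^M/2)`, `N ≤ (c+2)(M+1)` and
`2πσ(2K₇/A₀)(c+2)(M+1)³(ρ/s)^M ≤ 1`. [cite: Durrett2019, §3.5 proof of Theorem 3.5.3 (lane plumbing)] -/
private theorem arc_piece_a {K₇ ρ A₀ s σ N r cc : ℝ} {M : ℕ} (hs : 0 < s) (hA₀ : 0 < A₀) (hK₇ : 0 ≤ K₇) (hρ : 0 ≤ ρ) (hσ : 0 < σ)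
    (hr : 0 < r) (hkey : r * r = N) (hNle : N ≤ (cc + 2) * ((M : ℝ) + 1))
    (hM : 2 * π * σ * (2 * K₇ / A₀) * (cc + 2) * ((M : ℝ) + 1) ^ 3 * (ρ / s) ^ M ≤ 1) :
    K₇ * ((M : ℝ) + 1) ^ 2 * ρ ^ M / (A₀ * s ^ M / 2) * (2 * π * (σ * r)) ≤ 1 / r := by
  have hρpow : ρ ^ M = (ρ / s) ^ M * s ^ M := by
    rw [div_pow, div_mul_cancel₀ _ (pow_ne_zero _ hs.ne')]
  have e : 2 * π * σ * N * (K₇ * ((M : ℝ) + 1) ^ 2 * ρ ^ M / (A₀ * s ^ M / 2))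
      = (2 * π * σ * (2 * K₇ / A₀)) * (N * (((M : ℝ) + 1) ^ 2 * (ρ / s) ^ M)) := by
    rw [hρpow]; field_simp
  have hX0 : 0 ≤ ((M : ℝ) + 1) ^ 2 * (ρ / s) ^ M := by positivity
  have hc0 : 0 ≤ 2 * π * σ * (2 * K₇ / A₀) := by positivity
  have h1 : 2 * π * σ * N * (K₇ * ((M : ℝ) + 1) ^ 2 * ρ ^ M / (A₀ * s ^ M / 2)) ≤ 1 := by
    rw [e]
    calc (2 * π * σ * (2 * K₇ / A₀)) * (N * (((M : ℝ) + 1) ^ 2 * (ρ / s) ^ M))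
        ≤ (2 * π * σ * (2 * K₇ / A₀)) * ((cc + 2) * ((M : ℝ) + 1) * (((M : ℝ) + 1) ^ 2 * (ρ / s) ^ M)) :=
          mul_le_mul_of_nonneg_left (mul_le_mul_of_nonneg_right hNle hX0) hc0
      _ = 2 * π * σ * (2 * K₇ / A₀) * (cc + 2) * ((M : ℝ) + 1) ^ 3 * (ρ / s) ^ M := by ring
      _ ≤ 1 := hM
  rw [le_div_iff₀ hr]
  calc K₇ * ((M : ℝ) + 1) ^ 2 * ρ ^ M / (A₀ * s ^ M / 2) * (2 * π * (σ * r)) * r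
      = 2 * π * σ * N * (K₇ * ((M : ℝ) + 1) ^ 2 * ρ ^ M / (A₀ * s ^ M / 2)) := by
        linear_combination (2 * π * σ * (K₇ * ((M : ℝ) + 1) ^ 2 * ρ ^ M / (A₀ * s ^ M / 2))) * hkey
    _ ≤ 1 := h1

/-- Arc piece (b): `e^{−δ₁²N/2} · 2πσ√N ≤ 2πσ(2/δ₁²)/√N` (`x e^{−x} ≤ 1`). [cite: Durrett2019, §3.5 proof of Theorem 3.5.3 (lane plumbing)] -/
private theorem arc_piece_b {δ₁ σ N r : ℝ} (hδ₁ : 0 < δ₁) (hσ : 0 < σ) (hN : 0 < N) (hr : 0 < r) (hkey : r * r = N) :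
    Real.exp (-(δ₁ ^ 2 * N / 2)) * (2 * π * (σ * r)) ≤ 2 * π * σ * (2 / δ₁ ^ 2) / r := by
  have hx : δ₁ ^ 2 * N / 2 ≤ Real.exp (δ₁ ^ 2 * N / 2) := by linarith [Real.add_one_le_exp (δ₁ ^ 2 * N / 2)]
  have hδsq : 0 < δ₁ ^ 2 := by positivity
  have h1 : N * Real.exp (-(δ₁ ^ 2 * N / 2)) ≤ 2 / δ₁ ^ 2 := by
    rw [Real.exp_neg]
    have h2 : δ₁ ^ 2 * N / 2 * (Real.exp (δ₁ ^ 2 * N / 2))⁻¹ ≤ 1 := by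
      rw [← div_eq_mul_inv, div_le_one (Real.exp_pos _)]; exact hx
    calc N * (Real.exp (δ₁ ^ 2 * N / 2))⁻¹ = 2 / δ₁ ^ 2 * (δ₁ ^ 2 * N / 2 * (Real.exp (δ₁ ^ 2 * N / 2))⁻¹) := by
          field_simp
      _ ≤ 2 / δ₁ ^ 2 * 1 := by gcongr
      _ = 2 / δ₁ ^ 2 := mul_one _
  have hc0 : 0 ≤ 2 * π * σ := by positivity
  rw [le_div_iff₀ hr]
  calc Real.exp (-(δ₁ ^ 2 * N / 2)) * (2 * π * (σ * r)) * r = 2 * π * σ * (N * Real.exp (-(δ₁ ^ 2 * N / 2))) := by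
        linear_combination (2 * π * σ * Real.exp (-(δ₁ ^ 2 * N / 2))) * hkey
    _ ≤ 2 * π * σ * (2 / δ₁ ^ 2) := mul_le_mul_of_nonneg_left h1 hc0

/-- The Gaussian tail: `∫_{|θ| > R} e^{−θ²/2} dθ ≤ (∫ e^{−θ²/4}) · (R²/4)⁻¹` (`e^{−θ²/2} ≤ e^{−R²/4}e^{−θ²/4}` there and `e^{−x} ≤ 1/x`).
[cite: Durrett2019, §3.5 proof of Theorem 3.5.3 (lane plumbing)] -/
theorem gaussian_tail_le {R : ℝ} (hR : 0 < R) :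
    (∫ θ in (Icc (-R) R)ᶜ, Real.exp (-(θ ^ 2 / 2))) ≤ (∫ θ : ℝ, Real.exp (-(1 / 4 : ℝ) * θ ^ 2)) * (R ^ 2 / 4)⁻¹ := by
  have hFi : Integrable (fun θ : ℝ => Real.exp (-(R ^ 2 / 4)) * Real.exp (-(1 / 4 : ℝ) * θ ^ 2)) :=
    (integrable_exp_neg_mul_sq (by norm_num)).const_mul _
  have hpt : ∀ θ ∈ (Icc (-R) R)ᶜ, Real.exp (-(θ ^ 2 / 2)) ≤ Real.exp (-(R ^ 2 / 4)) * Real.exp (-(1 / 4 : ℝ) * θ ^ 2) := by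
    intro θ hθ
    rw [← Real.exp_add, Real.exp_le_exp]
    have hθ' : R ≤ |θ| := by
      rw [Set.mem_compl_iff, Set.mem_Icc, not_and_or, not_le, not_le] at hθ
      rcases hθ with h | h
      · rw [abs_of_neg (by linarith)]; linarith
      · exact le_trans h.le (le_abs_self θ)
    have hsq : R ^ 2 ≤ θ ^ 2 := by
      rw [← sq_abs θ]; exact pow_le_pow_left₀ hR.le hθ' 2
    linarith
  have hmono := integral_mono_of_nonneg (μ := volume.restrict (Icc (-R) R)ᶜ)
    (ae_of_all _ fun θ => (Real.exp_pos _).le) hFi.integrableOn (ae_restrict_of_forall_mem measurableSet_Icc.compl hpt)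
  refine hmono.trans ?_
  rw [integral_const_mul, mul_comm]
  have hle : (∫ θ in (Icc (-R) R)ᶜ, Real.exp (-(1 / 4 : ℝ) * θ ^ 2)) ≤ ∫ θ : ℝ, Real.exp (-(1 / 4 : ℝ) * θ ^ 2) :=
    setIntegral_le_integral (integrable_exp_neg_mul_sq (by norm_num)) (ae_of_all _ fun _ => (Real.exp_pos _).le)
  have hx0 : 0 < R ^ 2 / 4 := by positivity
  have hex : Real.exp (-(R ^ 2 / 4)) ≤ (R ^ 2 / 4)⁻¹ := by
    rw [Real.exp_neg]
    exact inv_anti₀ hx0 (by linarith [Real.add_one_le_exp (R ^ 2 / 4)])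
  exact mul_le_mul hle hex (Real.exp_pos _).le (integral_nonneg fun _ => (Real.exp_pos _).le)

/-- The window integral: if `F ≤ (C₁/r)e^{−θ²/8} + k` on `[−R, R]` (`C₁/r, k ≥ 0`) then `∫_{[−R,R]} F ≤ (C₁/r)·∫e^{−θ²/8} + k·2R`.
[cite: Durrett2019, §3.5 proof of Theorem 3.5.3 (lane plumbing)] -/
theorem setIntegral_le_of_majorant {F : ℝ → ℝ} {R a k : ℝ} (hR : 0 ≤ R) (ha : 0 ≤ a) (hF0 : ∀ θ, 0 ≤ F θ)
    (hF : ∀ θ ∈ Icc (-R) R, F θ ≤ a * Real.exp (-(1 / 8 : ℝ) * θ ^ 2) + k) :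
    (∫ θ in Icc (-R) R, F θ) ≤ a * (∫ θ : ℝ, Real.exp (-(1 / 8 : ℝ) * θ ^ 2)) + k * (2 * R) := by
  have hGi : Integrable (fun θ : ℝ => a * Real.exp (-(1 / 8 : ℝ) * θ ^ 2)) :=
    (integrable_exp_neg_mul_sq (by norm_num)).const_mul _
  have hvolS : volume.real (Icc (-R) R) = 2 * R := by
    rw [Real.volume_real_Icc_of_le (by linarith)]; ring
  have hmono := integral_mono_of_nonneg (μ := volume.restrict (Icc (-R) R))
    (ae_of_all _ fun θ => hF0 θ) (hGi.integrableOn.add (integrableOn_const (hs := measure_Icc_lt_top.ne)))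
    (ae_restrict_of_forall_mem measurableSet_Icc hF)
  refine hmono.trans ?_
  simp only [Pi.add_apply]
  rw [integral_add hGi.integrableOn (integrableOn_const (hs := measure_Icc_lt_top.ne)), setIntegral_const, hvolS,
    smul_eq_mul, integral_const_mul]
  have hle : (∫ θ in Icc (-R) R, Real.exp (-(1 / 8 : ℝ) * θ ^ 2)) ≤ ∫ θ : ℝ, Real.exp (-(1 / 8 : ℝ) * θ ^ 2) :=
    setIntegral_le_integral (integrable_exp_neg_mul_sq (by norm_num)) (ae_of_all _ fun _ => (Real.exp_pos _).le)
  have := mul_le_mul_of_nonneg_left hle ha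
  linarith

/-! ## §4 The estimate along one parity class -/

set_option maxHeartbeats 400000 in
-- budget line: one long bookkeeping proof (explicit constants, no search tactics).
/-- ★★ **The local limit estimate along `N = 2M + c`** (`y ≠ z + 1`): there are `C` and `M₀` such that for all `M ≥ M₀` and all integers `m`,
`|σ√N · P_{N,y,z}(bc = m) − (2π)^{−1/2} e^{−((m − N b)/(σ√N))²/2}| ≤ C/√N`, `N = 2M + c`.  Proof: the lattice inversion display
(`abs_scaled_atom_sub_gaussian_le'`) with the majorant `C₁e^{−θ²/8}/√N + (a_N + b_N)` on `[−πσ√N, πσ√N]` — inner window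
(`exists_inner_window`), outer window (`exists_outer_window` + `norm_sub_gauss_le_of_cubic_mul`), arc (`exists_norm_stripZ₂C_le_of_cos_le`
against `C_{1,N}(y,z) ≥ A₀ s^M/2` from `exists_complex_two_term_real_amplitude`) — and the Gaussian tail.
[cite: Durrett2019, §3.5 Theorem 3.5.3 and its proof (lane statement: rate form for the strip contact number); BeatonBousquetMelouDeGierDuminilCopinGuttmann2014, §3.2 Proposition 6 (arXiv v5 p. 10)] -/
theorem contact_localCLT_parity (hy : 0 < y) (hz : 0 < z) (hyz : y ≠ z + 1) (c : ℕ) :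
    ∃ C : ℝ, ∃ M₀ : ℕ, ∀ M : ℕ, M₀ ≤ M → ∀ m : ℤ,
      |Real.sqrt (deriv (fun A => contactB (Real.exp A) z) (Real.log y)) * Real.sqrt ((2 * M + c : ℕ) : ℝ) *
            ((∑ q ∈ (stripPairs 1 (2 * M + c)).filter (fun q => (bottomVisits₀ q.1 q.2 (2 * M + c) : ℝ) = m),
              wgt y z (2 * M + c) q) / stripZ₂ 1 (2 * M + c) y z)
          - (Real.sqrt (2 * π))⁻¹ * Real.exp (-(((m : ℝ) - ((2 * M + c : ℕ) : ℝ) * contactB y z)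
              / (Real.sqrt (deriv (fun A => contactB (Real.exp A) z) (Real.log y)) * Real.sqrt ((2 * M + c : ℕ) : ℝ))) ^ 2 / 2)|
        ≤ C / Real.sqrt ((2 * M + c : ℕ) : ℝ) := by
  -- the outer window (before naming `σ`, so that it is folded)
  obtain ⟨δ, Kc, N₀, hδ, hKc0, h4, Hout⟩ := exists_outer_window hy hz c
  set σ := Real.sqrt (deriv (fun A => contactB (Real.exp A) z) (Real.log y)) with hσ
  have hσpos : 0 < σ := by rw [hσ]; exact Real.sqrt_pos.2 (deriv_contactB_exp_pos hy hz)
  clear_value σ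
  -- the inner window
  obtain ⟨A₁, hA₁0, Hin⟩ := exists_inner_window hy hz (a := σ⁻¹) (by positivity)
  -- the arc: `δ₁ = min δ σ`, decay for `cos u ≤ cos(δ₁/σ)`
  obtain ⟨δ₁, hδ₁⟩ : ∃ δ₁ : ℝ, δ₁ = min δ σ := ⟨_, rfl⟩
  have hδ₁pos : 0 < δ₁ := by rw [hδ₁]; exact lt_min hδ hσpos
  have hδ₁δ : δ₁ ≤ δ := by rw [hδ₁]; exact min_le_left _ _
  have hδ₁σ : δ₁ ≤ σ := by rw [hδ₁]; exact min_le_right _ _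
  have hcos : Real.cos (δ₁ / σ) < 1 := by
    have h1 : 0 < δ₁ / σ := div_pos hδ₁pos hσpos
    have h2 : δ₁ / σ ≤ 1 := (div_le_one hσpos).2 hδ₁σ
    have hne : Real.cos (δ₁ / σ) ≠ 1 := by
      rw [Ne, Real.cos_eq_one_iff_of_lt_of_lt (by linarith [Real.pi_pos]) (by linarith [Real.pi_gt_three])]
      exact h1.ne'
    exact lt_of_le_of_ne (Real.cos_le_one _) hne
  obtain ⟨K₇, ρ, hK₇, hρ0, hρs, Harc⟩ := exists_norm_stripZ₂C_le_of_cos_le hy hz hyz c hcos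
  -- the real two-term asymptotics (lower bound of the partition function)
  obtain ⟨A₀, L, t₀, K, Θ, hA₀, hL0, ht₀, hK0, hΘ0, hΘs, -, hreal, -⟩ := exists_complex_two_term_real_amplitude hy hz c
  set s := stripMuY₂ 1 y z ^ 2 with hs
  have hspos : 0 < s := by rw [hs]; exact pow_pos (stripMuY₂_pos 1 hy hz) 2
  clear_value s
  have hΘs' : Θ < s := lt_of_lt_of_le hΘs (sub_le_self _ (mul_nonneg hL0 ht₀.le))
  -- thresholds
  obtain ⟨M₁, hM₁⟩ := exists_cube_geom_le_one (2 * K / A₀) (div_nonneg hΘ0 hspos.le) ((div_lt_one hspos).2 hΘs')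
  obtain ⟨M₂, hM₂⟩ := exists_cube_geom_le_one (2 * π * σ * (2 * K₇ / A₀) * ((c : ℝ) + 2))
    (div_nonneg hρ0 hspos.le) ((div_lt_one hspos).2 hρs)
  -- Gaussian constants
  obtain ⟨G₈, hG₈⟩ : ∃ G : ℝ, G = ∫ θ : ℝ, Real.exp (-(1 / 8 : ℝ) * θ ^ 2) := ⟨_, rfl⟩
  obtain ⟨G₄, hG₄⟩ : ∃ G : ℝ, G = ∫ θ : ℝ, Real.exp (-(1 / 4 : ℝ) * θ ^ 2) := ⟨_, rfl⟩
  have hG₄0 : 0 ≤ G₄ := by rw [hG₄]; exact integral_nonneg fun _ => (Real.exp_pos _).le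
  obtain ⟨C₁, hC₁⟩ : ∃ C₁ : ℝ, C₁ = 3 * A₁ + 2 * ((6 * Kc + 1) + 16 * (6 * Kc)) := ⟨_, rfl⟩
  have hC₁0 : 0 ≤ C₁ := by rw [hC₁]; positivity
  have hC₁a : 3 * A₁ ≤ C₁ := by rw [hC₁]; nlinarith only [hKc0]
  have hC₁b : 2 * ((6 * Kc + 1) + 16 * (6 * Kc)) ≤ C₁ := by rw [hC₁]; nlinarith only [hA₁0]
  refine ⟨1 / (2 * π) * (C₁ * G₈ + 1 + 2 * π * σ * (2 / δ₁ ^ 2) + G₄ * (4 / (π ^ 2 * σ ^ 2))),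
    max (max M₁ M₂) (N₀ + 1), fun M hM m => ?_⟩
  have hMM₁ : M₁ ≤ M := le_trans (le_max_left _ _) (le_trans (le_max_left _ _) hM)
  have hMM₂ : M₂ ≤ M := le_trans (le_max_right _ _) (le_trans (le_max_left _ _) hM)
  have hMN₀ : N₀ + 1 ≤ M := le_trans (le_max_right _ _) hM
  -- specialise at `M`, then name `N = 2M + c`
  have HoutM := Hout M (by omega)
  have hrealM := hreal M
  have HarcM : ∀ u : ℝ, Real.cos u ≤ Real.cos (δ₁ / σ) →
      ‖stripZ₂C 1 (2 * M + c) ((y : ℂ) * cexp ((u : ℂ) * I)) (z : ℂ)‖ ≤ K₇ * ((M : ℝ) + 1) ^ 2 * ρ ^ M :=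
    fun u hu => Harc u hu M
  have hNle : (((2 * M + c : ℕ) : ℝ)) ≤ ((c : ℝ) + 2) * ((M : ℝ) + 1) := by
    push_cast; nlinarith only [(Nat.cast_nonneg M : (0 : ℝ) ≤ M), (Nat.cast_nonneg c : (0 : ℝ) ≤ c)]
  have hN1' : 1 ≤ 2 * M + c := by omega
  obtain ⟨N, hNdef⟩ : ∃ N : ℕ, 2 * M + c = N := ⟨_, rfl⟩
  rw [hNdef] at HoutM hrealM HarcM hNle hN1' ⊢
  clear Hout hreal Harc
  have hNpos : (0 : ℝ) < N := by exact_mod_cast hN1'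
  have hsqN : 0 < Real.sqrt (N : ℝ) := Real.sqrt_pos.2 hNpos
  have hsqN1 : 1 ≤ Real.sqrt (N : ℝ) := Real.one_le_sqrt.2 (by exact_mod_cast hN1')
  have hkey : Real.sqrt (N : ℝ) * Real.sqrt N = N := Real.mul_self_sqrt hNpos.le
  have hsq_le_N : Real.sqrt (N : ℝ) ≤ N := by nlinarith only [hkey, hsqN1, hsqN]
  have hsNpos : 0 < σ * Real.sqrt N := mul_pos hσpos hsqN
  -- the lower bound of the partition function and the two arc constants
  have hZ : A₀ * s ^ M / 2 ≤ stripZ₂ 1 N y z := half_leading_le hA₀ hspos hK0 hΘ0 hrealM (hM₁ M hMM₁)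
  have hZpos : 0 < A₀ * s ^ M / 2 := by positivity
  obtain ⟨aN, haN⟩ : ∃ aN : ℝ, aN = K₇ * ((M : ℝ) + 1) ^ 2 * ρ ^ M / (A₀ * s ^ M / 2) := ⟨_, rfl⟩
  obtain ⟨bN, hbN⟩ : ∃ bN : ℝ, bN = Real.exp (-(δ₁ ^ 2 * N / 2)) := ⟨_, rfl⟩
  have haN0 : 0 ≤ aN := by rw [haN]; positivity
  have hbN0 : 0 ≤ bN := by rw [hbN]; positivity
  have haN1 : aN * (2 * π * (σ * Real.sqrt N)) ≤ 1 / Real.sqrt N := by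
    rw [haN]; exact arc_piece_a hspos hA₀ hK₇ hρ0 hσpos hsqN hkey hNle (hM₂ M hMM₂)
  have hbN1 : bN * (2 * π * (σ * Real.sqrt N)) ≤ 2 * π * σ * (2 / δ₁ ^ 2) / Real.sqrt N := by
    rw [hbN]; exact arc_piece_b hδ₁pos hσpos hNpos hsqN hkey
  -- the law of `bc` and the display
  haveI := contactCount_prob_eq_integral.isProbabilityMeasure_contactLaw_aux hy hz N
  have hdisp := abs_scaled_atom_sub_gaussian_le'
    (finLaw (stripPairs 1 N) (fun q => wgt y z N q / stripZ₂ 1 N y z) (fun q => (bottomVisits₀ q.1 q.2 N : ℝ)))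
    (ae_contactCountLaw_mem_int y z N) hsNpos ((N : ℝ) * contactB y z) m
  have hset : (finLaw (stripPairs 1 N) (fun q => wgt y z N q / stripZ₂ 1 N y z) (fun q => (bottomVisits₀ q.1 q.2 N : ℝ))).real {(m : ℝ)}
      = (∑ q ∈ (stripPairs 1 N).filter (fun q => (bottomVisits₀ q.1 q.2 N : ℝ) = m), wgt y z N q) / stripZ₂ 1 N y z := by
    rw [finLaw_real_apply _ _ (wgt_div_nonneg hy hz N), Finset.sum_div]
    refine Finset.sum_congr (Finset.filter_congr fun q _ => ?_) fun _ _ => rfl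
    simp
  rw [hset] at hdisp
  refine hdisp.trans ?_
  clear hdisp hset
  -- ### the pointwise majorant on `[−πσ√N, πσ√N]`
  have hFG : ∀ θ ∈ Icc (-(π * (σ * Real.sqrt N))) (π * (σ * Real.sqrt N)),
      ‖charFun (finLaw (stripPairs 1 N) (fun q => wgt y z N q / stripZ₂ 1 N y z) (fun q => (bottomVisits₀ q.1 q.2 N : ℝ)))
            (θ / (σ * Real.sqrt N)) * cexp (-((θ : ℂ) * ((((N : ℝ) * contactB y z) / (σ * Real.sqrt N) : ℝ) : ℂ) * I))
          - cexp (-((θ : ℂ) ^ 2 / 2))‖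
        ≤ C₁ / Real.sqrt N * Real.exp (-(1 / 8 : ℝ) * θ ^ 2) + (aN + bN) := by
    intro θ hθ
    rw [charFun_count_scaled_eq hy hz hN1' hσpos θ]
    have hθπ : |θ| ≤ π * (σ * Real.sqrt N) := abs_le.2 ⟨hθ.1, hθ.2⟩
    have hab : 0 ≤ aN + bN := add_nonneg haN0 hbN0
    rcases le_or_gt |θ| (1 / Real.sqrt N) with h1 | h1
    · -- the inner window `|θ| ≤ 1/√N`
      have hθ1 : |θ| ≤ 1 := h1.trans (by rw [div_le_one hsqN]; exact hsqN1)
      exact ((Hin N θ hθ1).trans (inner_piece hsqN1 hA₁0 hC₁a h1)).trans (le_add_of_nonneg_right hab)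
    rcases lt_or_ge |θ| (δ₁ * Real.sqrt N) with h2 | h2
    · -- the outer window `1/√N < |θ| < δ₁√N ≤ δ√N`
      obtain ⟨E, q, hφ, hE, hq, hq1⟩ := HoutM θ h1 (lt_of_lt_of_le h2 (mul_le_mul_of_nonneg_right hδ₁δ hsqN.le))
      rw [hφ]
      have hθ4 : 4 * Kc * |θ| ≤ Real.sqrt N := by
        have h44 : 0 ≤ 4 * Kc := by positivity
        calc 4 * Kc * |θ| ≤ 4 * Kc * (δ * Real.sqrt N) :=
              mul_le_mul_of_nonneg_left (h2.le.trans (mul_le_mul_of_nonneg_right hδ₁δ hsqN.le)) h44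
          _ = (4 * Kc * δ) * Real.sqrt N := by ring
          _ ≤ 1 * Real.sqrt N := mul_le_mul_of_nonneg_right h4 hsqN.le
          _ = Real.sqrt N := one_mul _
      exact ((norm_sub_gauss_le_of_cubic_mul hKc0 hsqN hθ4 hE hq hq1).trans (window_piece hsqN hKc0 hC₁b)).trans
        (le_add_of_nonneg_right hab)
    · -- the arc `δ₁√N ≤ |θ| ≤ πσ√N`
      have hnorm : ‖charFun ((contactLaw y z N).map (fun u => σ⁻¹ * u)) θ‖ ≤ aN := by
        rw [norm_charFun_contactLaw_map hy hz N σ⁻¹ θ, haN]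
        have hu : |σ⁻¹ * θ / Real.sqrt N| = |θ| / (σ * Real.sqrt N) := by
          rw [abs_div, abs_mul, abs_inv, abs_of_pos hσpos, abs_of_pos hsqN, inv_mul_eq_div, div_div]
        have hu1 : δ₁ / σ ≤ |σ⁻¹ * θ / Real.sqrt N| := by
          rw [hu, div_le_div_iff₀ hσpos hsNpos]
          nlinarith only [h2, hσpos]
        have hu2 : |σ⁻¹ * θ / Real.sqrt N| ≤ π := by
          rw [hu, div_le_iff₀ hsNpos]; exact hθπ
        have hcosu : Real.cos (σ⁻¹ * θ / Real.sqrt N) ≤ Real.cos (δ₁ / σ) := by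
          rw [← Real.cos_abs (σ⁻¹ * θ / Real.sqrt N)]
          exact Real.cos_le_cos_of_nonneg_of_le_pi (div_pos hδ₁pos hσpos).le hu2 hu1
        exact div_le_div₀ (by positivity) (HarcM _ hcosu) hZpos hZ
      have hg : ‖cexp (-((θ : ℂ) ^ 2 / 2))‖ ≤ bN := by
        rw [show (-((θ : ℂ) ^ 2 / 2)) = ((-(θ ^ 2 / 2) : ℝ) : ℂ) by push_cast; ring, Complex.norm_exp, Complex.ofReal_re, hbN,
          Real.exp_le_exp]
        have h3 : (δ₁ * Real.sqrt N) ^ 2 ≤ |θ| ^ 2 := pow_le_pow_left₀ (by positivity) h2 2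
        rw [mul_pow, Real.sq_sqrt hNpos.le, sq_abs] at h3
        linarith only [h3]
      calc _ ≤ ‖charFun ((contactLaw y z N).map (fun u => σ⁻¹ * u)) θ‖ + ‖cexp (-((θ : ℂ) ^ 2 / 2))‖ := norm_sub_le _ _
        _ ≤ aN + bN := add_le_add hnorm hg
        _ ≤ _ := le_add_of_nonneg_left (by positivity)
  -- ### the two integrals
  have hI := setIntegral_le_of_majorant (R := π * (σ * Real.sqrt N)) (by positivity) (div_nonneg hC₁0 hsqN.le)
    (fun θ => norm_nonneg _) hFG
  have hT : (∫ θ in (Icc (-(π * (σ * Real.sqrt N))) (π * (σ * Real.sqrt N)))ᶜ, Real.exp (-(θ ^ 2 / 2)))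
      ≤ G₄ * (4 / (π ^ 2 * σ ^ 2)) / Real.sqrt N := by
    refine (gaussian_tail_le (R := π * (σ * Real.sqrt N)) (by positivity)).trans ?_
    rw [← hG₄]
    have hval : ((π * (σ * Real.sqrt N)) ^ 2 / 4)⁻¹ = 4 / (π ^ 2 * σ ^ 2) / N := by
      rw [mul_pow, mul_pow, Real.sq_sqrt hNpos.le]; field_simp
    rw [hval]
    have h1 : 4 / (π ^ 2 * σ ^ 2) / (N : ℝ) ≤ 4 / (π ^ 2 * σ ^ 2) / Real.sqrt N :=
      div_le_div_of_nonneg_left (by positivity) hsqN hsq_le_N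
    calc G₄ * (4 / (π ^ 2 * σ ^ 2) / N) ≤ G₄ * (4 / (π ^ 2 * σ ^ 2) / Real.sqrt N) := mul_le_mul_of_nonneg_left h1 hG₄0
      _ = G₄ * (4 / (π ^ 2 * σ ^ 2)) / Real.sqrt N := by ring
  -- ### assembly
  rw [← hG₈] at hI
  have e : (C₁ * G₈ + 1 + 2 * π * σ * (2 / δ₁ ^ 2) + G₄ * (4 / (π ^ 2 * σ ^ 2))) / Real.sqrt N
      = C₁ / Real.sqrt N * G₈ + 1 / Real.sqrt N + 2 * π * σ * (2 / δ₁ ^ 2) / Real.sqrt N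
        + G₄ * (4 / (π ^ 2 * σ ^ 2)) / Real.sqrt N := by
    field_simp
  have hsplit : (aN + bN) * (2 * (π * (σ * Real.sqrt N)))
      = aN * (2 * π * (σ * Real.sqrt N)) + bN * (2 * π * (σ * Real.sqrt N)) := by ring
  have hπ0 : 0 ≤ 1 / (2 * π) := by positivity
  calc _ ≤ 1 / (2 * π) * ((C₁ * G₈ + 1 + 2 * π * σ * (2 / δ₁ ^ 2) + G₄ * (4 / (π ^ 2 * σ ^ 2))) / Real.sqrt N) := by
        refine mul_le_mul_of_nonneg_left ?_ hπ0
        rw [e]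
        linarith only [hI, haN1, hbN1, hT, hsplit]
    _ = _ := by ring

/-! ## §5 ★★★ The local central limit theorem -/

/-- ★★★ **THE LOCAL CENTRAL LIMIT THEOREM FOR THE CONTACT NUMBER, WITH RATE.**  For `y, z > 0` with `y ≠ z + 1` there is a constant
`C = C(y,z)` such that for EVERY `N ≥ 1` and EVERY integer `m`,
`|σ√N · P_{N,y,z}(bc = m) − (2π)^{−1/2} exp(−(m − N b(y,z))²/(2σ²N))| ≤ C/√N`,
where `P_{N,y,z}(bc = m) = Σ_{q : bc(q) = m} y^{bc(q)} z^{tc(q)}/C_{1,N}(y,z)`, `b(y,z)` is the contact density and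
`σ² = d/dA b(e^A, z)|_{A = log y} > 0` the CLT variance: the point probabilities of the contact number are, uniformly in `m`, the Gaussian
density at the standardised point divided by `σ√N`, up to `O(1/N)`.  (Durrett's Theorem 3.5.3 gives `o(1/√N)` for i.i.d. lattice sums;
the rate comes from the cubic control of the two-term asymptotics.)  Gluing of the two parity classes (`contact_localCLT_parity`); small `N`
by the trivial bound.
[cite: Durrett2019, §3.5 Theorem 3.5.3 (local limit theorem for lattice laws; lane statement: rate form for the strip contact number); BeatonBousquetMelouDeGierDuminilCopinGuttmann2014, §3.2 Proposition 6 (arXiv v5 p. 10)] -/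
theorem contact_localCLT (hy : 0 < y) (hz : 0 < z) (hyz : y ≠ z + 1) :
    ∃ C : ℝ, ∀ N : ℕ, 1 ≤ N → ∀ m : ℤ,
      |Real.sqrt (deriv (fun A => contactB (Real.exp A) z) (Real.log y)) * Real.sqrt (N : ℝ) *
            ((∑ q ∈ (stripPairs 1 N).filter (fun q => (bottomVisits₀ q.1 q.2 N : ℝ) = m), wgt y z N q) / stripZ₂ 1 N y z)
          - (Real.sqrt (2 * π))⁻¹ * Real.exp (-(((m : ℝ) - (N : ℝ) * contactB y z)
              / (Real.sqrt (deriv (fun A => contactB (Real.exp A) z) (Real.log y)) * Real.sqrt (N : ℝ))) ^ 2 / 2)|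
        ≤ C / Real.sqrt (N : ℝ) := by
  classical
  obtain ⟨C₀, M₀, H₀⟩ := contact_localCLT_parity hy hz hyz 0
  obtain ⟨C₁, M₁, H₁⟩ := contact_localCLT_parity hy hz hyz 1
  set σ := Real.sqrt (deriv (fun A => contactB (Real.exp A) z) (Real.log y)) with hσ
  have hσpos : 0 < σ := by rw [hσ]; exact Real.sqrt_pos.2 (deriv_contactB_exp_pos hy hz)
  clear_value σ
  -- threshold
  obtain ⟨N₁, hN₁⟩ : ∃ N₁ : ℕ, N₁ = 2 * max M₀ M₁ + 2 := ⟨_, rfl⟩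
  have hN₁pos : (0 : ℝ) < N₁ := by rw [hN₁]; positivity
  refine ⟨max (max C₀ C₁) ((σ * Real.sqrt N₁ + 1) * Real.sqrt N₁), fun N hN m => ?_⟩
  have hNpos : (0 : ℝ) < N := by exact_mod_cast hN
  have hsqN : 0 < Real.sqrt (N : ℝ) := Real.sqrt_pos.2 hNpos
  by_cases hsmall : N < N₁
  · -- small `N`: the trivial bound `≤ σ√N₁ + 1 ≤ (σ√N₁ + 1)√N₁/√N`
    have hP0 : 0 ≤ (∑ q ∈ (stripPairs 1 N).filter (fun q => (bottomVisits₀ q.1 q.2 N : ℝ) = m), wgt y z N q) / stripZ₂ 1 N y z :=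
      div_nonneg (Finset.sum_nonneg fun q _ => wgt_nonneg hy.le hz.le N q) (stripZ₂_pos 1 N hy hz).le
    have hP1 : (∑ q ∈ (stripPairs 1 N).filter (fun q => (bottomVisits₀ q.1 q.2 N : ℝ) = m), wgt y z N q) / stripZ₂ 1 N y z ≤ 1 := by
      rw [div_le_one (stripZ₂_pos 1 N hy hz), stripZ₂_one_eq_sum_wgt]
      exact Finset.sum_le_sum_of_subset_of_nonneg (Finset.filter_subset _ _) fun q _ _ => wgt_nonneg hy.le hz.le N q
    have he0 : 0 < Real.exp (-(((m : ℝ) - (N : ℝ) * contactB y z) / (σ * Real.sqrt (N : ℝ))) ^ 2 / 2) := Real.exp_pos _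
    have he1 : Real.exp (-(((m : ℝ) - (N : ℝ) * contactB y z) / (σ * Real.sqrt (N : ℝ))) ^ 2 / 2) ≤ 1 :=
      Real.exp_le_one_iff.2 (by
        have := sq_nonneg (((m : ℝ) - (N : ℝ) * contactB y z) / (σ * Real.sqrt (N : ℝ)))
        linarith)
    have hc0 : 0 < (Real.sqrt (2 * π))⁻¹ := by positivity
    have hc1 : (Real.sqrt (2 * π))⁻¹ ≤ 1 :=
      inv_le_one_of_one_le₀ (Real.one_le_sqrt.2 (by linarith [Real.pi_gt_three]))
    have hsqle : Real.sqrt (N : ℝ) ≤ Real.sqrt N₁ := Real.sqrt_le_sqrt (by exact_mod_cast hsmall.le)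
    have hA0 : 0 ≤ σ * Real.sqrt (N : ℝ) *
        ((∑ q ∈ (stripPairs 1 N).filter (fun q => (bottomVisits₀ q.1 q.2 N : ℝ) = m), wgt y z N q) / stripZ₂ 1 N y z) :=
      mul_nonneg (mul_nonneg hσpos.le hsqN.le) hP0
    have hA1 : σ * Real.sqrt (N : ℝ) *
        ((∑ q ∈ (stripPairs 1 N).filter (fun q => (bottomVisits₀ q.1 q.2 N : ℝ) = m), wgt y z N q) / stripZ₂ 1 N y z)
          ≤ σ * Real.sqrt N₁ := by
      calc _ ≤ σ * Real.sqrt (N : ℝ) * 1 := mul_le_mul_of_nonneg_left hP1 (mul_nonneg hσpos.le hsqN.le)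
        _ ≤ σ * Real.sqrt N₁ := by rw [mul_one]; exact mul_le_mul_of_nonneg_left hsqle hσpos.le
    have hB1 : (Real.sqrt (2 * π))⁻¹ * Real.exp (-(((m : ℝ) - (N : ℝ) * contactB y z) / (σ * Real.sqrt (N : ℝ))) ^ 2 / 2) ≤ 1 := by
      calc _ ≤ 1 * 1 := mul_le_mul hc1 he1 he0.le zero_le_one
        _ = 1 := one_mul _
    have hB0 : 0 ≤ (Real.sqrt (2 * π))⁻¹ * Real.exp (-(((m : ℝ) - (N : ℝ) * contactB y z) / (σ * Real.sqrt (N : ℝ))) ^ 2 / 2) :=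
      mul_nonneg hc0.le he0.le
    have hlhs : |σ * Real.sqrt (N : ℝ) *
          ((∑ q ∈ (stripPairs 1 N).filter (fun q => (bottomVisits₀ q.1 q.2 N : ℝ) = m), wgt y z N q) / stripZ₂ 1 N y z)
        - (Real.sqrt (2 * π))⁻¹ * Real.exp (-(((m : ℝ) - (N : ℝ) * contactB y z) / (σ * Real.sqrt (N : ℝ))) ^ 2 / 2)|
        ≤ σ * Real.sqrt N₁ + 1 := by
      rw [abs_le]; constructor <;> linarith only [hA0, hA1, hB0, hB1]
    refine hlhs.trans ?_
    rw [le_div_iff₀ hsqN]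
    have h1 : (σ * Real.sqrt N₁ + 1) * Real.sqrt (N : ℝ) ≤ (σ * Real.sqrt N₁ + 1) * Real.sqrt N₁ :=
      mul_le_mul_of_nonneg_left hsqle (by positivity)
    exact h1.trans (le_max_right _ _)
  · -- `N ≥ N₁`: parity split
    have hge : N₁ ≤ N := not_lt.1 hsmall
    obtain ⟨M, hM⟩ : ∃ M : ℕ, N = 2 * M + N % 2 := ⟨N / 2, by omega⟩
    have hMge : max M₀ M₁ ≤ M := by omega
    rcases Nat.mod_two_eq_zero_or_one N with h0 | h1
    · rw [h0] at hM
      have h := H₀ M (le_trans (le_max_left _ _) hMge) m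
      rw [show 2 * M + 0 = N by omega] at h
      exact h.trans (div_le_div_of_nonneg_right (le_trans (le_max_left _ _) (le_max_left _ _)) (Real.sqrt_nonneg _))
    · rw [h1] at hM
      have h := H₁ M (le_trans (le_max_right _ _) hMge) m
      rw [show 2 * M + 1 = N by omega] at h
      exact h.trans (div_le_div_of_nonneg_right (le_trans (le_max_right _ _) (le_max_left _ _)) (Real.sqrt_nonneg _))

end WidthOneYZ

end Literature.Probability.RandomPlanarGeometry.SAW.HexBW

end
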